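import Literature.NumberTheory.EllipticCurves.MazurTorsionStepOneAtNProofs
import Literature.NumberTheory.EllipticCurves.MazurTorsionStepTwoHasseProofs
import Literature.NumberTheory.EllipticCurves.VariableChangePointsMap
import HarnessLib

/-!
# Mazur 1977, Ch. III §5: the reduction at `q = N` itself — anomalous, or split multiplicative

Sibling proof file (theorems only) of `MazurTorsionLocalStepsProofs` and
`MazurTorsionStepOneAtNProofs`, for the prime-case leaf
`Literature.NumberTheory.EllipticCurves.Mazur1977_no_prime_torsion W` (B. Mazur, *Modular curves
and the Eisenstein ideal*, Publ. Math. IHÉS 47 (1977), Ch. III §5, pp. 156–160).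

Step 2 of the printed proof analyses the primes `q = 2, 3` through `E₀(ℚ_q) → Ẽ_ns(𝔽_q)`,
whose kernel `E₁` has no `N`-torsion because `N` is a `q`-adic unit. At `q = N` the same analysis
goes through once one knows that `E₁(ℚ_N)` has no `N`-torsion either — Silverman, *AEC*,
IV.6.1/VII.3.1 for `K = ℚ_N` (`e = 1 < N - 1`), in the tree as
`not_prime_zsmul_eq_zero_of_one_lt_norm` (`MazurTorsionStepOneAtNProofs`, by division
polynomials). For the putative curve of the leaf (a rational point `P` of prime order
`N ∉ {2, 3, 5, 7, 13}`) this gives, at the prime `N`: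

* `not_hasNonsingularReduction_of_node` — multiplicative reduction at `N` forces `P ∉ E₀(ℚ_N)`
  (Mazur's "(E_{/𝔽_q})⁰ ≅ 𝔾_m", p. 159, at `q = N`: `E₀/E₁ ↪ 𝔽̄_Nˣ`, which has no element of order
  `N`), hence split multiplicative reduction with `N ∣ c_N` (Kodaira–Néron);
* `prime_dvd_natCard_reduction` — good reduction at `N` forces `N ∣ #Ẽ(𝔽_N)`, hence by the
  Riemann hypothesis `#Ẽ(𝔽_N) = N` exactly (**anomalous** reduction);
* `Mazur1977_at_N` — with Step 1 at `N` (`Mazur1977_stepOne_at_N`, no additive reduction):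
  the reduction of the putative curve at `N` is good and anomalous, or split multiplicative with
  `N ∣ c_N = ord_N(Δ_min)`.
* `Mazur1977_dvd_natCard_reduction` — at every prime `q` of good reduction, `N ∣ #Ẽ(𝔽_q)`
  (`a_q ≡ q + 1 (mod N)`; at `q ≠ N` this is *AEC* VII.3.1(b), at `q = N` the above).

## References

* [Mazur1977] B. Mazur, *Modular curves and the Eisenstein ideal*, Publ. Math. IHÉS 47 (1977),
  Ch. III §5, Steps 1–2, pp. 158–159.
* [SilvermanAEC2009] J. H. Silverman, *The Arithmetic of Elliptic Curves*, 2nd ed. (2009),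
  V.1.1, VII.2.1, VII.3.1, VII.5.1.
* [SilvermanATAEC1994] J. H. Silverman, *Advanced Topics*, IV.9 Cor. 9.2(d).

## Design

No definitions; `noncomputable section`, `open scoped Classical` as in the sibling files.
-/

noncomputable section

open scoped Classical

namespace Literature.NumberTheory.EllipticCurves

open _root_.WeierstrassCurve

variable {p : ℕ} [Fact p.Prime]

/-! ## §1 Over `ℤ_p`: a non-zero point killed by `p` does not reduce to `O` (`p` odd) -/

/-- **`E₁(ℚ_p)[p] = 0`** in the language of `ReductionHomomorphism`: a non-zero `ℚ_p`-point of a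
`p`-integral equation killed by the odd prime `p` does not reduce to the point at infinity
(its abscissa is `p`-integral). [cite: SilvermanAEC2009, VII.3 Prop. 3.1 and IV.6 Thm. 6.1] -/
theorem not_reducesToZero_of_prime_zsmul_eq_zero (hp3 : 3 ≤ p) (W₀ : WeierstrassCurve ℤ_[p])
    [(W₀.baseChange ℚ_[p]).IsElliptic] {P : (W₀.baseChange ℚ_[p]).toAffine.Point} (hP0 : P ≠ 0)
    (hpP : (p : ℤ) • P = 0) : ¬ W₀.ReducesToZero P := by
  rcases P with _ | ⟨x, y, h⟩
  · exact absurd rfl hP0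
  rw [reducesToZero_some_iff]
  intro hx
  have hx1 : 1 < ‖x‖ := by
    by_contra hle
    push Not at hle
    exact hx ⟨⟨x, hle⟩, rfl⟩
  exact not_prime_zsmul_eq_zero_of_one_lt_norm hp3 W₀ h hx1 hpP

/-! ## §2 Multiplicative reduction: `E₀/E₁ ↪ 𝔽̄_pˣ` has no element of order `p` -/

/-- `𝔽̄_p = AlgebraicClosure (𝓀(ℤ_p))` has characteristic `p`. [folklore] -/
theorem charP_algebraicClosure_residueField :
    CharP (AlgebraicClosure (IsLocalRing.ResidueField ℤ_[p])) p := by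
  refine (CharP.charP_iff_prime_eq_zero Fact.out).mpr ?_
  have h0 : (p : IsLocalRing.ResidueField ℤ_[p]) = 0 := by
    rw [show (p : IsLocalRing.ResidueField ℤ_[p]) = IsLocalRing.residue ℤ_[p] (p : ℤ_[p]) by
      rw [map_natCast], IsLocalRing.residue_eq_zero_iff, PadicInt.maximalIdeal_eq_span_p]
    exact Ideal.mem_span_singleton_self _
  rw [show (p : AlgebraicClosure (IsLocalRing.ResidueField ℤ_[p])) =
      algebraMap (IsLocalRing.ResidueField ℤ_[p]) _ (p : IsLocalRing.ResidueField ℤ_[p]) by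
    rw [map_natCast], h0, map_zero]

/-- **Multiplicative reduction at `p` (odd): a non-zero point killed by `p` lies outside `E₀`**
(Mazur 1977, p. 159, "(E_{/𝔽_q})⁰ is isomorphic to `𝔾_m`", at `q = p`): on a `p`-integral equation
whose reduction is a node, `E₀(ℚ_p)/E₁(ℚ_p)` embeds in `𝔽̄_pˣ` (Silverman, *AEC* VII.2.1 with
III.2.5; tree `exists_addMonoidHom_units_of_node`), which has no element of order `p`
(`x^p = 1 ⇒ (x - 1)^p = 0`); and `E₁(ℚ_p)` has no `p`-torsion.
[cite: Mazur1977, Ch. III §5, Step 2, p. 159; SilvermanAEC2009, VII.2 Prop. 2.1, III.2.5, VII.3 Prop. 3.1] -/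
theorem not_hasNonsingularReduction_of_node (hp3 : 3 ≤ p) (W₀ : WeierstrassCurve ℤ_[p])
    [(W₀.baseChange ℚ_[p]).IsElliptic] (hΔ : IsLocalRing.residue ℤ_[p] W₀.Δ = 0)
    (hc₄ : IsLocalRing.residue ℤ_[p] W₀.c₄ ≠ 0) {P : (W₀.baseChange ℚ_[p]).toAffine.Point}
    (hP0 : P ≠ 0) (hpP : (p : ℤ) • P = 0) : ¬ W₀.HasNonsingularReduction P := by
  intro hP
  have hv := integers_valuationRing_valuation ℤ_[p] ℚ_[p]
  obtain ⟨r, hr⟩ := W₀.exists_addMonoidHom_units_of_node hv hΔ hc₄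
  set P₀ : W₀.nonsingularReductionSubgroup hv := ⟨P, hP⟩ with hP₀
  have hpP₀ : (p : ℤ) • P₀ = 0 := Subtype.ext (by simpa using hpP)
  -- `u := r P₀` satisfies `u ^ p = 1` in `𝔽̄_pˣ`, hence `u = 1`
  haveI := charP_algebraicClosure_residueField (p := p)
  set u : (AlgebraicClosure (IsLocalRing.ResidueField ℤ_[p]))ˣ := Additive.toMul (r P₀) with hu
  have hup : u ^ p = 1 := by
    have h1 : (p : ℤ) • r P₀ = 0 := by rw [← map_zsmul, hpP₀, map_zero]
    have h2 := congrArg Additive.toMul h1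
    rwa [toMul_zsmul, toMul_zero, zpow_natCast] at h2
  have hu1 : u = 1 := by
    apply Units.ext
    have h1 : ((u : (AlgebraicClosure (IsLocalRing.ResidueField ℤ_[p]))) - 1) ^ p = 0 := by
      rw [sub_pow_char, one_pow, ← Units.val_pow_eq_pow_val, hup, Units.val_one, sub_self]
    exact sub_eq_zero.mp (pow_eq_zero_iff (Fact.out : p.Prime).ne_zero |>.mp h1)
  have hr0 : r P₀ = 0 := by
    apply Additive.toMul.injective
    rw [← hu, hu1, toMul_zero]
  exact not_reducesToZero_of_prime_zsmul_eq_zero hp3 W₀ hP0 hpP ((hr P₀).mp hr0)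

/-- The same on a model with multiplicative reduction (Mathlib's `HasMultiplicativeReduction`:
minimal, `v(Δ) < 1`, `v(c₄) = 1`): a non-zero point killed by the odd prime `p` lies outside
`E₀ = goodReductionSubgroup`. [cite: Mazur1977, Ch. III §5, Step 2, p. 159; SilvermanAEC2009, VII.5 Prop. 5.1(b)] -/
theorem not_mem_goodReductionSubgroup_of_hasMultiplicativeReduction (hp3 : 3 ≤ p)
    (V : WeierstrassCurve ℚ_[p]) [V.IsElliptic] [hm : V.HasMultiplicativeReduction ℤ_[p]]
    {P : V.toAffine.Point} (hP0 : P ≠ 0) (hpP : (p : ℤ) • P = 0) :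
    P ∉ V.goodReductionSubgroup ℤ_[p] := by
  have hΔ := hm.badReduction
  have hc₄ := hm.multiplicativeReduction
  obtain ⟨W₀, rfl⟩ : ∃ W₀ : WeierstrassCurve ℤ_[p], V = W₀.baseChange ℚ_[p] := IsIntegral.integral
  have eΔ : (W₀.baseChange ℚ_[p]).Δ = algebraMap ℤ_[p] ℚ_[p] W₀.Δ := map_Δ W₀ (algebraMap ℤ_[p] ℚ_[p])
  have ec : (W₀.baseChange ℚ_[p]).c₄ = algebraMap ℤ_[p] ℚ_[p] W₀.c₄ := map_c₄ W₀ (algebraMap ℤ_[p] ℚ_[p])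
  rw [eΔ, IsDedekindDomain.HeightOneSpectrum.valuation_lt_one_iff_mem] at hΔ
  rw [ec, IsDedekindDomain.HeightOneSpectrum.valuation_eq_one_iff_notMem] at hc₄
  have hΔ' : IsLocalRing.residue ℤ_[p] W₀.Δ = 0 := (IsLocalRing.residue_eq_zero_iff _).mpr hΔ
  have hc₄' : IsLocalRing.residue ℤ_[p] W₀.c₄ ≠ 0 :=
    fun h => hc₄ ((IsLocalRing.residue_eq_zero_iff _).mp h)
  rw [goodReductionSubgroup_baseChange_eq, mem_nonsingularReductionSubgroup_iff]
  exact not_hasNonsingularReduction_of_node hp3 W₀ hΔ' hc₄' hP0 hpP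

/-! ## §3 Good reduction: `p ∣ #Ẽ(𝔽_p)` -/

/-- **Good reduction at `p` (odd): a non-zero point killed by `p` forces `p ∣ #Ẽ(𝔽_p)`**:
every point has nonsingular reduction, the reduction homomorphism `E(ℚ_p) → Ẽ(𝔽_p)`
(*AEC* VII.2.1) is injective on `⟨P⟩` since its kernel `E₁(ℚ_p)` contains no non-zero point
killed by `p` (`not_reducesToZero_of_prime_zsmul_eq_zero`), and `#⟨P⟩ = p`.
[cite: SilvermanAEC2009, VII.2 Prop. 2.1 and VII.3 Prop. 3.1] -/
theorem prime_dvd_natCard_of_isUnit_Δ (hp3 : 3 ≤ p) (W₀ : WeierstrassCurve ℤ_[p])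
    [(W₀.baseChange ℚ_[p]).IsElliptic] (hΔ : IsUnit W₀.Δ)
    [Finite (W₀.map (IsLocalRing.residue ℤ_[p])).toAffine.Point]
    {P : (W₀.baseChange ℚ_[p]).toAffine.Point} (hP0 : P ≠ 0) (hpP : (p : ℤ) • P = 0) :
    p ∣ Nat.card (W₀.map (IsLocalRing.residue ℤ_[p])).toAffine.Point := by
  have hP' : p.Prime := Fact.out
  have hv := integers_valuationRing_valuation ℤ_[p] ℚ_[p]
  have hle : AddSubgroup.zmultiples P ≤ W₀.nonsingularReductionSubgroup hv :=
    AddSubgroup.zmultiples_le_of_mem (hasNonsingularReduction_of_isUnit_Δ hv hΔ P)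
  set f : AddSubgroup.zmultiples P →+ (W₀.map (IsLocalRing.residue ℤ_[p])).toAffine.Point :=
    (W₀.reductionHom hv).comp (AddSubgroup.inclusion hle) with hf_def
  have hf : Function.Injective f := by
    rw [injective_iff_map_eq_zero]
    rintro ⟨Q, hQ⟩ hfQ
    obtain ⟨m, rfl⟩ := AddSubgroup.mem_zmultiples_iff.mp hQ
    have hred : W₀.reducePoint (m • P) = 0 := hfQ
    have h0 : W₀.ReducesToZero (m • P) :=
      (_root_.WeierstrassCurve.reducePoint_eq_zero_iff hv (hle hQ)).mp hred
    by_contra hne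
    have hne' : m • P ≠ 0 := fun h => hne (Subtype.ext h)
    have hp' : (p : ℤ) • (m • P) = 0 := by rw [← mul_zsmul, mul_comm, mul_zsmul, hpP, zsmul_zero]
    exact not_reducesToZero_of_prime_zsmul_eq_zero hp3 W₀ hne' hp' h0
  have hord : addOrderOf P = p := by
    refine addOrderOf_eq_prime ?_ hP0
    rw [← natCast_zsmul]; exact hpP
  calc p = Nat.card (AddSubgroup.zmultiples P) := by rw [Nat.card_zmultiples, hord]
    _ ∣ Nat.card (W₀.map (IsLocalRing.residue ℤ_[p])).toAffine.Point :=
        AddSubgroup.card_dvd_of_injective f hf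

/-- The same on a model with good reduction (Mathlib's `HasGoodReduction`), for the canonical
reduction `V.reduction ℤ_p = (integralModel).map (residue)`: a non-zero point killed by the odd
prime `p` forces `p ∣ #Ẽ(𝔽_p)`. [cite: SilvermanAEC2009, VII.2 Prop. 2.1 and VII.3 Prop. 3.1] -/
theorem prime_dvd_natCard_reduction (hp3 : 3 ≤ p) (V : WeierstrassCurve ℚ_[p]) [V.IsElliptic]
    [hg : V.HasGoodReduction ℤ_[p]] {P : V.toAffine.Point} (hP0 : P ≠ 0)
    (hpP : (p : ℤ) • P = 0) : p ∣ Nat.card (V.reduction ℤ_[p]).toAffine.Point := by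
  set W₀ : WeierstrassCurve ℤ_[p] := V.integralModel ℤ_[p] with hW₀
  have hV : W₀.baseChange ℚ_[p] = V := baseChange_integralModel_eq ℤ_[p] V
  have hΔ : IsUnit W₀.Δ := by
    have h1 := hg.goodReduction
    rw [← integralModel_Δ_eq ℤ_[p] V,
      IsDedekindDomain.HeightOneSpectrum.valuation_eq_one_iff_notMem] at h1
    by_contra hu
    exact h1 ((IsLocalRing.mem_maximalIdeal _).mpr hu)
  haveI : (W₀.baseChange ℚ_[p]).IsElliptic := by rw [hV]; infer_instance
  haveI : Finite (IsLocalRing.ResidueField ℤ_[p]) :=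
    Finite.of_equiv (ZMod p) (PadicInt.residueField (p := p)).symm.toEquiv
  haveI := Fintype.ofFinite (IsLocalRing.ResidueField ℤ_[p])
  haveI : Finite (W₀.map (IsLocalRing.residue ℤ_[p])).toAffine.Point := finite_point _
  set e := Affine.Point.congrEquiv hV.symm with he
  have hQ0 : e P ≠ 0 := fun h0 => hP0 (e.injective (h0.trans e.map_zero.symm))
  have hpQ : (p : ℤ) • e P = 0 := by rw [← map_zsmul, hpP, map_zero]
  exact prime_dvd_natCard_of_isUnit_Δ hp3 W₀ hΔ hQ0 hpQ

/-! ## §4 Over `ℚ` at `q = N`: anomalous good reduction, or split multiplicative with `N ∣ c_N` -/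

section Rat

variable (W : WeierstrassCurve ℚ) [W.IsElliptic] (N : ℕ) [Fact N.Prime]

omit [Fact N.Prime] in
/-- `#Ẽ(𝔽_N) = N` from `N ∣ #Ẽ(𝔽_N)` and the Riemann hypothesis (`N ≥ 7`):
`0 < #Ẽ ≤ N + 1 + 2√N < 2N`. [cite: SilvermanAEC2009, Thm. V.1.1] -/
theorem eq_of_dvd_of_hasse {c : ℕ} (h7 : 7 ≤ N) (hc0 : 0 < c) (hdvd : N ∣ c)
    (hH : |(c : ℝ) - (N + 1)| ≤ 2 * Real.sqrt N) : c = N := by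
  obtain ⟨m, rfl⟩ := hdvd
  have hm0 : m ≠ 0 := by rintro rfl; simp at hc0
  rcases Nat.lt_or_ge m 2 with hm | hm
  · interval_cases m
    · exact absurd rfl hm0
    · rw [mul_one]
  · exfalso
    have hs : 0 ≤ Real.sqrt N := Real.sqrt_nonneg _
    have hsq : Real.sqrt N ^ 2 = N := Real.sq_sqrt (Nat.cast_nonneg _)
    have hN : (7 : ℝ) ≤ N := by exact_mod_cast h7
    have h2 : (2 : ℝ) * N ≤ N * m := by
      have : (2 : ℝ) ≤ m := by exact_mod_cast hm
      nlinarith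
    have hle := (abs_le.mp hH).2
    push_cast at hle
    nlinarith

/-- **The reduction at `N` of the putative curve**: let `E/ℚ` have a rational point of prime
order `N ∉ {2, 3, 5, 7, 13}`. Then at `N` the reduction of `E` is either **good and anomalous**
(`#Ẽ(𝔽_N) = N`), or **split multiplicative with `N ∣ c_N(E)`** — additive reduction is excluded
by Step 1 (`Mazur1977_stepOne_at_N`); multiplicative reduction puts the point off `E₀(ℚ_N)`
(`not_mem_goodReductionSubgroup_of_hasMultiplicativeReduction`), whence split with `N ∣ c_N` by
Kodaira–Néron (`hasSplitMultiplicativeReduction_of_not_mem_goodReductionSubgroup`); good reduction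
gives `N ∣ #Ẽ(𝔽_N)` (`prime_dvd_natCard_reduction`) and the Riemann hypothesis pins `#Ẽ(𝔽_N) = N`.
(Mazur's Step 2 analysis, printed for `q = 2, 3`, carried out at `q = N`.)
[cite: Mazur1977, Ch. III §5, Steps 1–2, pp. 158–159; SilvermanAEC2009, Thm. V.1.1, VII.2.1, VII.3.1; SilvermanATAEC1994, Cor. IV.9.2(d) (PDF p. 340)] -/
theorem Mazur1977_at_N (hNS : N ∉ ({2, 3, 5, 7, 13} : Finset ℕ)) {P : W.toAffine.Point}
    (hP : addOrderOf P = N) :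
    (W.HasGoodReductionAtPrime N ∧
        Nat.card (((W.baseChange ℚ_[N]).minimal ℤ_[N]).reduction ℤ_[N]).toAffine.Point = N) ∨
      (W.HasSplitMultiplicativeReductionAtPrime N ∧
        N ∣ (W.baseChange ℚ_[N]).localTamagawaNumber ℤ_[N]) := by
  have hN : N.Prime := Fact.out
  have h11 := eleven_le_of_prime_of_not_mem hN hNS
  haveI : (W.baseChange ℚ_[N]).IsElliptic := inferInstanceAs (W.map (algebraMap ℚ ℚ_[N])).IsElliptic
  have hmin : (W.baseChange ℚ_[N]).minimal ℤ_[N] =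
      ((W.baseChange ℚ_[N]).exists_isMinimal ℤ_[N]).choose • W.baseChange ℚ_[N] := rfl
  haveI : ((W.baseChange ℚ_[N]).minimal ℤ_[N]).IsElliptic := by
    rw [hmin]
    infer_instance
  haveI : Finite (IsLocalRing.ResidueField ℤ_[N]) :=
    Finite.of_equiv (ZMod N) (PadicInt.residueField (p := N)).symm.toEquiv
  haveI : PerfectField (IsLocalRing.ResidueField ℤ_[N]) := PerfectField.ofFinite
  set P' : ((W.baseChange ℚ_[N]).minimal ℤ_[N]).toAffine.Point :=
    VariableChange.pointEquiv (W.baseChange ℚ_[N])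
      ((W.baseChange ℚ_[N]).exists_isMinimal ℤ_[N]).choose
      (Affine.Point.map (W' := W.toAffine) (S := ℚ) (Algebra.ofId ℚ ℚ_[N]) P) with hP'
  have hP'ord : addOrderOf P' = N :=
    ((AddEquiv.addOrderOf_eq _ _).trans (addOrderOf_injective _
      (Affine.Point.map_injective (W' := W.toAffine) (f := Algebra.ofId ℚ ℚ_[N])) P)).trans hP
  have hP'0 : P' ≠ 0 := by
    intro h0
    rw [h0, addOrderOf_zero] at hP'ord
    exact absurd hP'ord.symm (by omega)
  have hkill' : N • P' = 0 := by
    have e := addOrderOf_nsmul_eq_zero P'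
    rwa [hP'ord] at e
  have hkill : (N : ℤ) • P' = 0 := by rw [natCast_zsmul]; exact hkill'
  rcases hasGoodReduction_or_hasMultiplicativeReduction_or_hasAdditiveReduction ℤ_[N]
      (W := (W.baseChange ℚ_[N]).minimal ℤ_[N]) with hg | hm | ha
  · -- good: anomalous
    left
    refine ⟨hg, ?_⟩
    haveI := hg
    have hdvd := prime_dvd_natCard_reduction (p := N) (by omega)
      ((W.baseChange ℚ_[N]).minimal ℤ_[N]) hP'0 hkill
    haveI : (((W.baseChange ℚ_[N]).minimal ℤ_[N]).reduction ℤ_[N]).IsElliptic :=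
      (hasGoodReduction_iff_isElliptic_reduction (R := ℤ_[N])).mp hg
    haveI := Fintype.ofFinite (IsLocalRing.ResidueField ℤ_[N])
    haveI : Finite (((W.baseChange ℚ_[N]).minimal ℤ_[N]).reduction ℤ_[N]).toAffine.Point :=
      finite_point _
    have h2 : ringChar (IsLocalRing.ResidueField ℤ_[N]) ≠ 2 := by
      rw [CharP.ringChar_of_prime_eq_zero hN (by
        rw [show (N : IsLocalRing.ResidueField ℤ_[N]) = IsLocalRing.residue ℤ_[N] (N : ℤ_[N]) by
          rw [map_natCast], IsLocalRing.residue_eq_zero_iff, PadicInt.maximalIdeal_eq_span_p]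
        exact Ideal.mem_span_singleton_self _)]
      omega
    have h3 : ringChar (IsLocalRing.ResidueField ℤ_[N]) ≠ 3 := by
      rw [CharP.ringChar_of_prime_eq_zero hN (by
        rw [show (N : IsLocalRing.ResidueField ℤ_[N]) = IsLocalRing.residue ℤ_[N] (N : ℤ_[N]) by
          rw [map_natCast], IsLocalRing.residue_eq_zero_iff, PadicInt.maximalIdeal_eq_span_p]
        exact Ideal.mem_span_singleton_self _)]
      omega
    have hH := (((W.baseChange ℚ_[N]).minimal ℤ_[N]).reduction
      ℤ_[N]).abs_natCard_point_sub_le_of_ringChar_ne h2 h3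
    rw [← Nat.card_eq_fintype_card, natCard_residueField_padicInt] at hH
    exact eq_of_dvd_of_hasse N (by omega) Nat.card_pos hdvd hH
  · -- multiplicative: off `E₀`, split, `N ∣ c_N`
    right
    haveI := hm
    have hnot := not_mem_goodReductionSubgroup_of_hasMultiplicativeReduction (p := N) (by omega)
      ((W.baseChange ℚ_[N]).minimal ℤ_[N]) hP'0 hkill
    obtain ⟨hsplit, hdvd⟩ := hasSplitMultiplicativeReduction_of_not_mem_goodReductionSubgroup ℤ_[N]
      ((W.baseChange ℚ_[N]).minimal ℤ_[N]) hN (by omega) hkill' hnot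
    exact ⟨hsplit, hdvd⟩
  · exact absurd ha (Mazur1977_stepOne_at_N W N h11 hP)

/-! ### `N ∣ #Ẽ(𝔽_q)` at every prime of good reduction -/

/-- **Good reduction at `q ≠ ℓ`: a non-zero point killed by the prime `ℓ` forces `ℓ ∣ #Ẽ(𝔽_q)`**
(the divisibility form of Silverman, *AEC* VII.3.1(b): `⟨P⟩ ↪ Ẽ(𝔽_q)`, the kernel `E₁(ℚ_q)`
having no prime-to-`q` torsion). [cite: SilvermanAEC2009, VII.3 Prop. 3.1(b)] -/
theorem prime_dvd_natCard_reduction_of_ne {q : ℕ} [Fact q.Prime] {ℓ : ℕ} (hp : ℓ.Prime) (hqp : q ≠ ℓ)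
    (V : WeierstrassCurve ℚ_[q]) [V.IsElliptic] [hg : V.HasGoodReduction ℤ_[q]]
    {P : V.toAffine.Point} (hP0 : P ≠ 0) (hpP : (ℓ : ℤ) • P = 0) :
    ℓ ∣ Nat.card (V.reduction ℤ_[q]).toAffine.Point := by
  set W₀ : WeierstrassCurve ℤ_[q] := V.integralModel ℤ_[q] with hW₀
  have hV : W₀.baseChange ℚ_[q] = V := baseChange_integralModel_eq ℤ_[q] V
  have hΔ : IsUnit W₀.Δ := by
    have h1 := hg.goodReduction
    rw [← integralModel_Δ_eq ℤ_[q] V,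
      IsDedekindDomain.HeightOneSpectrum.valuation_eq_one_iff_notMem] at h1
    by_contra hu
    exact h1 ((IsLocalRing.mem_maximalIdeal _).mpr hu)
  haveI : Finite (IsLocalRing.ResidueField ℤ_[q]) :=
    Finite.of_equiv (ZMod q) (PadicInt.residueField (p := q)).symm.toEquiv
  haveI := Fintype.ofFinite (IsLocalRing.ResidueField ℤ_[q])
  haveI : Finite (W₀.map (IsLocalRing.residue ℤ_[q])).toAffine.Point := finite_point _
  set e := Affine.Point.congrEquiv hV.symm with he
  have hQ0 : e P ≠ 0 := fun h0 => hP0 (e.injective (h0.trans e.map_zero.symm))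
  have hpQ : (ℓ : ℤ) • e P = 0 := by rw [← map_zsmul, hpP, map_zero]
  have hv := integers_valuationRing_valuation ℤ_[q] ℚ_[q]
  have hpv : ValuationRing.valuation ℤ_[q] ℚ_[q] ((ℓ : ℤ) : ℚ_[q]) = 1 := by
    rw [show ((ℓ : ℤ) : ℚ_[q]) = algebraMap ℤ_[q] ℚ_[q] (ℓ : ℤ_[q]) by simp, v_algebraMap_eq_one_iff hv]
    simpa using natCast_residueField_padicInt_ne_zero q hp hqp
  haveI : Fact ℓ.Prime := ⟨hp⟩
  have hord : addOrderOf (e P) = ℓ := by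
    refine addOrderOf_eq_prime ?_ hQ0
    rw [← natCast_zsmul]; exact hpQ
  calc ℓ = addOrderOf (e P) := hord.symm
    _ ∣ Nat.card (W₀.map (IsLocalRing.residue ℤ_[q])).toAffine.Point := by
        -- `⟨e P⟩ ↪ Ẽ(𝔽_q)` (tree `addOrderOf_le_natCard_of_hasNonsingularReduction`, divisibility form)
        have hle : AddSubgroup.zmultiples (e P) ≤ W₀.nonsingularReductionSubgroup hv :=
          AddSubgroup.zmultiples_le_of_mem (hasNonsingularReduction_of_isUnit_Δ hv hΔ (e P))
        set f : AddSubgroup.zmultiples (e P) →+ (W₀.map (IsLocalRing.residue ℤ_[q])).toAffine.Point :=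
          (W₀.reductionHom hv).comp (AddSubgroup.inclusion hle) with hf_def
        have hf : Function.Injective f := by
          rw [injective_iff_map_eq_zero]
          rintro ⟨Q, hQ⟩ hfQ
          obtain ⟨m, rfl⟩ := AddSubgroup.mem_zmultiples_iff.mp hQ
          have hred : W₀.reducePoint (m • e P) = 0 := hfQ
          have h0 : W₀.ReducesToZero (m • e P) :=
            (_root_.WeierstrassCurve.reducePoint_eq_zero_iff hv (hle hQ)).mp hred
          have hp' : (ℓ : ℤ) • (m • e P) = 0 := by
            rw [← mul_zsmul, mul_comm, mul_zsmul, hpQ, zsmul_zero]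
          by_contra hne
          exact not_reducesToZero_of_zsmul_eq_zero hv hpv hp' (fun h => hne (Subtype.ext h)) h0
        rw [← Nat.card_zmultiples]
        exact AddSubgroup.card_dvd_of_injective f hf

/-- **`N ∣ #Ẽ(𝔽_q)` at every prime `q` of good reduction** for an elliptic curve over `ℚ` with a
rational point of prime order `N ∉ {2, 3, 5, 7, 13}` (the classical congruence
`a_q ≡ q + 1 (mod N)`): at `q ≠ N` by *AEC* VII.3.1(b) (`prime_dvd_natCard_reduction_of_ne`),
at `q = N` by `prime_dvd_natCard_reduction` (`E₁(ℚ_N)[N] = 0`).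
[cite: SilvermanAEC2009, VII.3 Prop. 3.1(b); Mazur1977, Ch. III §5, Step 2, p. 159] -/
theorem Mazur1977_dvd_natCard_reduction (W : WeierstrassCurve ℚ) [W.IsElliptic] {N : ℕ}
    (hN : N.Prime) (hNS : N ∉ ({2, 3, 5, 7, 13} : Finset ℕ)) {P : W.toAffine.Point}
    (hP : addOrderOf P = N) (q : ℕ) [Fact q.Prime] (hgood : W.HasGoodReductionAtPrime q) :
    N ∣ Nat.card (((W.baseChange ℚ_[q]).minimal ℤ_[q]).reduction ℤ_[q]).toAffine.Point := by
  have h11 := eleven_le_of_prime_of_not_mem hN hNS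
  haveI : (W.baseChange ℚ_[q]).IsElliptic := inferInstanceAs (W.map (algebraMap ℚ ℚ_[q])).IsElliptic
  have hmin : (W.baseChange ℚ_[q]).minimal ℤ_[q] =
      ((W.baseChange ℚ_[q]).exists_isMinimal ℤ_[q]).choose • W.baseChange ℚ_[q] := rfl
  haveI : ((W.baseChange ℚ_[q]).minimal ℤ_[q]).IsElliptic := by
    rw [hmin]
    infer_instance
  haveI : ((W.baseChange ℚ_[q]).minimal ℤ_[q]).HasGoodReduction ℤ_[q] := hgood
  set P' : ((W.baseChange ℚ_[q]).minimal ℤ_[q]).toAffine.Point :=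
    VariableChange.pointEquiv (W.baseChange ℚ_[q])
      ((W.baseChange ℚ_[q]).exists_isMinimal ℤ_[q]).choose
      (Affine.Point.map (W' := W.toAffine) (S := ℚ) (Algebra.ofId ℚ ℚ_[q]) P) with hP'
  have hP'ord : addOrderOf P' = N :=
    ((AddEquiv.addOrderOf_eq _ _).trans (addOrderOf_injective _
      (Affine.Point.map_injective (W' := W.toAffine) (f := Algebra.ofId ℚ ℚ_[q])) P)).trans hP
  have hP'0 : P' ≠ 0 := by
    intro h0
    rw [h0, addOrderOf_zero] at hP'ord
    exact absurd hP'ord.symm (by omega)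
  have hkill : (N : ℤ) • P' = 0 := by
    have e := addOrderOf_nsmul_eq_zero P'
    rw [hP'ord] at e
    rw [natCast_zsmul]
    exact e
  by_cases hqN : q = N
  · have h3 : 3 ≤ q := by omega
    rw [← hqN] at hkill ⊢
    exact prime_dvd_natCard_reduction (p := q) h3 _ hP'0 hkill
  · exact prime_dvd_natCard_reduction_of_ne hN hqN _ hP'0 hkill

end Rat

end Literature.NumberTheory.EllipticCurves

end
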